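import Summits.BirchSwinnertonDyer.Rank1Residual.Additive.AdditiveReductionPrimeToPDivisible
import Summits.BirchSwinnertonDyer.Rank1Residual.Additive.FouquetWanPointTransport
import Literature.NumberTheory.EllipticCurves.NeronComponentIndexTypeIVProofs
import Literature.NumberTheory.EllipticCurves.NeronComponentIndexTypeIVstarProofs
import Literature.NumberTheory.EllipticCurves.TamagawaRingEquivProofs
import Literature.NumberTheory.EllipticCurves.VariableChangePoints
import Literature.NumberTheory.EllipticCurves.RootNumberProofs
import Literature.NumberTheory.DiophantineGeometry.TateAlgorithmProofs
import Literature.NumberTheory.DiophantineGeometry.TateAlgorithmAdditiveProofs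
import HarnessLib

/-!
# T-O6-μ PROVED: `LocalThreeTorsionIffTamagawaThreeOfIV` — at a Kodaira type `IV` / `IV*` prime
# `q ≠ 3`, `E(ℚ_q)` has a point of order `3` iff `c_q = 3`
# (cell `b2b-bsdres`, lane CLASS-CLOSURE / class O6; cross-cell pool work of seat `b2b-bsdres-x11b3-p4`
# GEN 9 under the x11b3 lead's P-POOL rule R12-38 (b); first refusals: cc-typer-5 GEN 10 'NO OBJECTION,
# naming confirmed', o6-r1 / o6-r2; THEOREMS ONLY)

HONEST FRAMING (cell `b2b-bsdres`, run/shared/lean/b2b/bsd-rank1-residual/, verbatim in every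
file): the goal of the cell is to DELETE the COMBINATION-SHAPED residual classes of the
Birch–Swinnerton-Dyer formula for ALL analytic-rank `≤ 1` elliptic curves over `ℚ` — "full BSD
formula for every rank `≤ 1` curve in class `C`" assembled STRICTLY from published theorems — so
that the rank-`≤ 1` remainder becomes exactly the CONSTRUCTION-SHAPED classes, which are TYPED
(missing-input `Prop`s), NOT attempted. This is not "finishing BSD". This file: THEOREMS ONLY (no
definition, no named fact, no `sorry`, no `@[conjecture]` node); nothing about any particular curve
is asserted; nothing is booked; no mark of `RESIDUAL-MAP.md` moves; O6 stays OPEN.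

## What is proved

o6-r1 GEN 9's / cc-typer-5 GEN 5's typed TARGET **T-O6-μ**
`Summit.BirchSwinnertonDyer.Rank1Residual.Additive.LocalThreeTorsionIffTamagawaThreeOfIV`
(`Additive/FouquetWanPointTransport.lean` §2, p283772: "For `W/ℚ` elliptic with Kodaira type `IV`
or `IV*` at a prime `q ≠ 3`: `E(ℚ_q)` has a point of order `3` iff `c_q = 3`", a published local
lemma — Silverman *AEC* VII.2.1 / VII.6.1 / Table 15.1 — typed there "for a later kernel proof") is
a tree theorem:

* `localThreeTorsionIffTamagawaThreeOfIV_holds : LocalThreeTorsionIffTamagawaThreeOfIV`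
  (binders verbatim: any `W/ℚ` with `[W.IsElliptic]`, any prime `q ≠ 3`, any wildness at `q = 2`).

WHAT IS NOT CLAIMED: this is the LOCAL-GROUP half of the `μ`-law of `FouquetWanPointTransport`
(o6-r1 GEN 9 (G9-2)). Its GALOIS half — `E[3]^{I_q} = E[3](ℚ_q^{nr}) ≅ Φ_q[3]`, `Frob_q` acting on
that line by `μ(Frob_q)·q`, hence `μ_q = −1 ⟺ ([c_q = 3] ⟺ [q ≡ 2 (mod 3)])` and the reading of
`FWNonsplitAddThree` as Fouquet–Wan's third hypothesis — is NOT claimed here and stays (G9-2)'s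
reading; `FWNonsplitAddThree` / `FouquetWanPointClaimShape` are untouched; the census 28 306 +
33 318 / 0 stays EVIDENCE.

## Proof

With `K = ℚ_[q]`, `R = ℤ_[q]` and `M = I ⊗ K` the chosen `R`-minimal model of `W ⊗ K`
(`I` over `R`):
1. (`§1`) Kodaira `IV`/`IV*` at the place `(q)` of `ℤ` gives `c_q ∈ {1, 3}` — the tree's discharged
   Tate-algorithm facts `localTamagawaNumber_of_kodairaSymbolAt_eq_IV_holds` /
   `…_eq_IVstar_holds` (Silverman *ATAEC* IV.9.4 Steps 5, 8) at `placeOf q`, transported from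
   `ℚ_(q)` to Mathlib's `ℚ_[q]` along `Rat.HeightOneSpectrum.adicCompletion.padicEquiv` by the tree's
   `localTamagawaNumber_map_ringEquiv` (the `R := ℤ` twin of `localTamagawaNumber_padic_eq_holds`) —
   and ADDITIVE reduction of `M` (`isAdditive_kodairaSymbolAt_iff_holds`, the prime/place bridges
   `hasGood/MultiplicativeReductionAtPrime_iff_…At_holds`, Mathlib's trichotomy for minimal
   equations).
2. (sibling `Additive/AdditiveReductionPrimeToPDivisible.lean`, x11b3-p4 GEN 9 FILE 1) at an
   additive place `E₀(K)` is uniquely `3`-divisible (`3 ∈ ℤ_q^×` as `q ≠ 3`), so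
   `E(K)[3] ≠ 0 ⟺ [E(K) : E₀(K)] = 3` once the index is `1` or `3`
   (`CuspDivision.exists_ne_zero_and_nsmul_eq_zero_iff_index_eq_of_hasAdditiveReduction`).
3. (`§2`) transport of `3`-torsion along `W ⊗ K ≃ M = I ⊗ K` (`VariableChange.pointEquiv`,
   `Affine.Point.congrEquiv`) and of the index (`c_q` is by definition the index of `E₀` of `M`;
   `goodReductionSubgroup_baseChange_eq`).

References: J. H. Silverman, *The Arithmetic of Elliptic Curves*, 2nd ed. (2009), VII.2.1, VII.3.1,
VII.6.1, Table 15.1 [SilvermanAEC2009]; *Advanced Topics* (1994), IV.9.4 Steps 5 and 8, IV.9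
Remark 9.2.2, Cor. IV.9.2 [SilvermanATAEC1994]; cell: `cells/o5o6/TARGETS.md` §O6 (G9-2),
INBOX INTENT 2026-08-21T20:20Z (x11b3-p4 GEN 9), x11b3-lead R12-38 (b), cc-typer-5 GEN 10 first refusal.

## Design

No definitions; `noncomputable section`; `open scoped Classical`. Axioms: `propext`,
`Classical.choice`, `Quot.sound`.
-/

noncomputable section

open scoped Classical

namespace Summit.BirchSwinnertonDyer.Rank1Residual.Additive

open WeierstrassCurve IsDedekindDomain Rat.HeightOneSpectrum Literature.NumberTheory.EllipticCurves
  Literature.NumberTheory.EllipticCurves.Rank1Residual Literature.NumberTheory.DiophantineGeometry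

/-! ### §1 The place `(q)` of `ℤ` versus Mathlib's `ℚ_[q]`: `c_q ∈ {1, 3}` and additivity at a `IV`/`IV*` prime -/

section Place

variable (W : WeierstrassCurve ℚ) [W.IsElliptic]

/-- **`c(W/ℚ_[p]) = c_v`** for a place `v` over the prime `p` (`primesEquiv v = p`) of ANY Dedekind
domain `R` with fraction field `ℚ` (`R = ℤ` below; `R = 𝓞 ℚ` is the tree's
`localTamagawaNumber_padic_eq_holds`): the same transport along Mathlib's
`padicEquiv v : ℚ_v ≃ ℚ_[p]` / `padicIntEquiv v` (`localTamagawaNumber_map_ringEquiv`; Silverman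
*AEC* VII.6 Ex. 7.6: `c` is attached to `E/K`). Stated for a general `R` so that the only
`ℤ`-algebra structure on `𝓞_v` in the statement's elaboration is the canonical one.
[cite: SilvermanAEC2009, VII.6 Ex. 7.6 and VII.1 Prop. 1.3(b) (PDF p. 165)] -/
theorem localTamagawaNumber_padic_eq_of_primesEquiv_eq' {R : Type*} [CommRing R] [Algebra R ℚ]
    [IsDedekindDomain R] [IsFractionRing R ℚ] [IsIntegralClosure R ℤ ℚ] (v : HeightOneSpectrum R) (p : ℕ)
    [Fact p.Prime] (hv : (primesEquiv (R := R) v : ℕ) = p) :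
    (W.baseChange ℚ_[p]).localTamagawaNumber ℤ_[p] =
      (W.baseChange (v.adicCompletion ℚ)).localTamagawaNumber (v.adicCompletionIntegers ℚ) := by
  subst hv
  have hc : ∀ r : v.adicCompletionIntegers ℚ,
      (adicCompletion.padicEquiv v).toRingEquiv (algebraMap _ (v.adicCompletion ℚ) r) =
        algebraMap ℤ_[(primesEquiv v : ℕ)] ℚ_[(primesEquiv v : ℕ)]
          ((adicCompletionIntegers.padicIntEquiv v).toRingEquiv r) := fun r ↦ rfl
  have hW : (W.baseChange (v.adicCompletion ℚ)).map
      ((adicCompletion.padicEquiv v).toRingEquiv : v.adicCompletion ℚ →+* ℚ_[(primesEquiv v : ℕ)]) =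
        W.baseChange ℚ_[(primesEquiv v : ℕ)] := by
    rw [baseChange, baseChange, map_map]
    congr 1
    exact Subsingleton.elim _ _
  haveI : (W.baseChange (v.adicCompletion ℚ)).IsElliptic := by unfold baseChange; infer_instance
  rw [← hW, localTamagawaNumber_map_ringEquiv _ _ hc]

variable (q : ℕ) [hq : Fact q.Prime]

/-- The place `placeOf q` of `ℤ` lies over `q`: `primesEquiv (placeOf q) = q`. [folklore] -/
theorem primesEquiv_placeOf_val : (primesEquiv (R := ℤ) (placeOf q) : ℕ) = q :=
  congrArg Subtype.val ((primesEquiv (R := ℤ)).apply_symm_apply ⟨q, hq.out⟩)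

/-- **`c_q` computed over Mathlib's `ℤ_[q] ⊆ ℚ_[q]` is the place-indexed `c_v` at `v = placeOf q`**
(the currency of `kodairaSymbolAt (placeOf q)` and of the Tate-algorithm facts).
[cite: SilvermanAEC2009, VII.6 Ex. 7.6] -/
theorem localTamagawaNumber_padic_eq_placeOf :
    (W.baseChange ℚ_[q]).localTamagawaNumber ℤ_[q] =
      (W.baseChange ((placeOf q).adicCompletion ℚ)).localTamagawaNumber
        ((placeOf q).adicCompletionIntegers ℚ) :=
  localTamagawaNumber_padic_eq_of_primesEquiv_eq' W (placeOf q) q (primesEquiv_placeOf_val q)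

/-- **`c_q ∈ {1, 3}` at a Kodaira type `IV` / `IV*` prime** (Silverman *ATAEC* IV.9.4 Step 5:
"Type IV … `c = 3` if `k' = k`, `c = 1` if `k' ≠ k`"; Step 8: the same for IV*): the tree's
discharged facts `localTamagawaNumber_of_kodairaSymbolAt_eq_IV_holds` / `…_eq_IVstar_holds` at
`placeOf q`, read over `ℤ_[q]`. [cite: SilvermanATAEC1994, IV.9.4 Steps 5 and 8 (PDF pp. 344, 346)] -/
theorem localTamagawaNumber_padic_eq_one_or_three_of_hasKodairaIVOrIVstarAt
    (hK : HasKodairaIVOrIVstarAt W q) :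
    (W.baseChange ℚ_[q]).localTamagawaNumber ℤ_[q] = 1 ∨
      (W.baseChange ℚ_[q]).localTamagawaNumber ℤ_[q] = 3 := by
  rw [localTamagawaNumber_padic_eq_placeOf W q]
  rcases hK with h | h
  · exact localTamagawaNumber_of_kodairaSymbolAt_eq_IV_holds (placeOf q) W h
  · exact localTamagawaNumber_of_kodairaSymbolAt_eq_IVstar_holds (placeOf q) W h

/-- **A Kodaira type `IV` / `IV*` prime is a prime of ADDITIVE reduction** in the prime-indexed
currency `Addv W q` (= neither the `ℤ_[q]`-minimal model has good nor multiplicative reduction):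
`IV`, `IV*` are additive symbols, so `W` has additive reduction at `placeOf q`
(`isAdditive_kodairaSymbolAt_iff_holds`, Silverman *ATAEC* IV.9.4 / *AEC* VII.5.1(c)), which
excludes good (`v(Δ) = 1` vs `< 1`) and multiplicative (`v(c₄) = 1` vs `< 1`) reduction of the
same local minimal model, and the prime/place bridges
`hasGood/MultiplicativeReductionAtPrime_iff_…At_holds` carry this to `ℤ_[q]`.
[cite: SilvermanAEC2009, VII.5 Prop. 5.1 (PDF p. 174)] [cite: SilvermanATAEC1994, IV.9.4] -/
theorem addv_of_hasKodairaIVOrIVstarAt (hK : HasKodairaIVOrIVstarAt W q) : Addv W q := by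
  have hKA : (W.kodairaSymbolAt (placeOf q)).IsAdditive := by
    rcases hK with h | h <;> rw [h] <;>
      exact ⟨fun h0 ↦ KodairaSymbol.noConfusion h0, fun ⟨_, _, hn⟩ ↦ KodairaSymbol.noConfusion hn⟩
  have hA : W.HasAdditiveReductionAt (placeOf q) :=
    (isAdditive_kodairaSymbolAt_iff_holds (placeOf q) W).mp hKA
  refine ⟨fun hg ↦ ?_, fun hm ↦ ?_⟩
  · have hg' : W.HasGoodReductionAt (placeOf q) :=
      (W.hasGoodReductionAtPrime_iff_hasGoodReductionAt_holds ⟨q, hq.out⟩).mp hg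
    exact absurd hg'.goodReduction hA.badReduction.ne
  · have hm' : W.HasMultiplicativeReductionAt (placeOf q) :=
      (W.hasMultiplicativeReductionAtPrime_iff_hasMultiplicativeReductionAt_holds ⟨q, hq.out⟩).mp hm
    exact absurd hm'.multiplicativeReduction hA.additiveReduction.ne

omit [W.IsElliptic] in
/-- **`Addv W q` ⟹ the chosen `ℤ_[q]`-minimal model of `W ⊗ ℚ_[q]` has ADDITIVE reduction**
(Mathlib's trichotomy `good ∨ multiplicative ∨ additive` for minimal equations; `Addv` negates the
first two by definition). [cite: SilvermanAEC2009, VII.5 Prop. 5.1 (PDF p. 174)] -/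
theorem hasAdditiveReduction_minimal_padic_of_addv (hadd : Addv W q) :
    ((W.baseChange ℚ_[q]).minimal ℤ_[q]).HasAdditiveReduction ℤ_[q] := by
  rcases hasGoodReduction_or_hasMultiplicativeReduction_or_hasAdditiveReduction (R := ℤ_[q])
      (W := (W.baseChange ℚ_[q]).minimal ℤ_[q]) with h | h | h
  · exact absurd h hadd.1
  · exact absurd h hadd.2
  · exact h

omit hq in
/-- `3` is a unit of `ℤ_q` for a prime `q ≠ 3` (`‖3‖_q = 1`). [folklore] -/
theorem isUnit_three_padicInt [Fact q.Prime] (h3 : q ≠ 3) : IsUnit ((3 : ℕ) : ℤ_[q]) := by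
  have hlt : ¬ ‖((3 : ℤ) : ℤ_[q])‖ < 1 := by
    rw [PadicInt.norm_int_lt_one_iff_dvd]
    intro hd
    exact h3 ((Nat.prime_dvd_prime_iff_eq (Fact.out : q.Prime) Nat.prime_three).mp
      (Int.natCast_dvd_natCast.mp hd))
  have hcast : ((3 : ℕ) : ℤ_[q]) = ((3 : ℤ) : ℤ_[q]) := by norm_cast
  rw [PadicInt.isUnit_iff, hcast]
  exact le_antisymm (PadicInt.norm_le_one _) (not_lt.mp hlt)

end Place

/-! ### §2 Assembly: the TARGET as a theorem -/

/-- An additive isomorphism preserves "there is a nonzero element killed by `n`". [folklore] -/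
theorem exists_ne_zero_nsmul_eq_zero_iff_of_addEquiv {A B : Type*} [AddCommGroup A] [AddCommGroup B]
    (e : A ≃+ B) (n : ℕ) :
    (∃ a : A, a ≠ 0 ∧ n • a = 0) ↔ ∃ b : B, b ≠ 0 ∧ n • b = 0 := by
  constructor
  · rintro ⟨a, ha0, ha⟩
    exact ⟨e a, by rwa [Ne, e.map_eq_zero_iff], by rw [← map_nsmul, ha, map_zero]⟩
  · rintro ⟨b, hb0, hb⟩
    exact ⟨e.symm b, by rwa [Ne, e.symm.map_eq_zero_iff], by rw [← map_nsmul, hb, map_zero]⟩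

/-- **T-O6-μ PROVED: `LocalThreeTorsionIffTamagawaThreeOfIV` holds.** For every elliptic `W/ℚ`
and every prime `q ≠ 3` of Kodaira type `IV` or `IV*`: `E(ℚ_q)` has a point of order `3` iff
`c_q = 3` (Silverman *AEC* VII.2.1 / VII.6.1 / Table 15.1; *ATAEC* IV.9 Rem. 9.2.2: `E₀(ℚ_q)` is
uniquely `3`-divisible at an additive `q ≠ 3`, so `E(ℚ_q)[3] ≅ (E(ℚ_q)/E₀(ℚ_q))[3]`, and
`#E(ℚ_q)/E₀(ℚ_q) = c_q ∈ {1, 3}` by Tate's algorithm). Assembly of §1 with FILE 1's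
`CuspDivision.exists_ne_zero_and_nsmul_eq_zero_iff_index_eq_of_hasAdditiveReduction` on the chosen
`ℤ_[q]`-minimal model `M = I ⊗ ℚ_[q] = C • (W ⊗ ℚ_[q])`, transporting the `3`-torsion along
`VariableChange.pointEquiv` / `Affine.Point.congrEquiv` and the index along
`goodReductionSubgroup_baseChange_eq`. The GALOIS half of the `μ`-law is NOT claimed (module
docstring). Feed `localThreeTorsionIffTamagawaThreeOfIV_holds` wherever
`(h : LocalThreeTorsionIffTamagawaThreeOfIV)` would be a binder.
[cite: SilvermanAEC2009, VII.2 Prop. 2.1, VII.6 Thm. 6.1 and Table 15.1 (App. C)]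
[cite: SilvermanATAEC1994, IV.9 Remark 9.2.2, Cor. IV.9.2, IV.9.4 Steps 5 and 8] -/
theorem localThreeTorsionIffTamagawaThreeOfIV_holds : LocalThreeTorsionIffTamagawaThreeOfIV := by
  intro W _ q _ hq3 hK
  -- the chosen `ℤ_[q]`-minimal model `M = C • (W ⊗ ℚ_q) = I ⊗ ℚ_q` has additive reduction
  haveI hM : ((W.baseChange ℚ_[q]).minimal ℤ_[q]).HasAdditiveReduction ℤ_[q] :=
    hasAdditiveReduction_minimal_padic_of_addv W q (addv_of_hasKodairaIVOrIVstarAt W q hK)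
  obtain ⟨C, hC⟩ : ∃ C : VariableChange ℚ_[q],
      (W.baseChange ℚ_[q]).minimal ℤ_[q] = C • W.baseChange ℚ_[q] := ⟨_, rfl⟩
  obtain ⟨I, hI⟩ : ∃ I : WeierstrassCurve ℤ_[q],
      (W.baseChange ℚ_[q]).minimal ℤ_[q] = I.baseChange ℚ_[q] := IsIntegral.integral
  haveI hIadd : (I.baseChange ℚ_[q]).HasAdditiveReduction ℤ_[q] := hI ▸ hM
  haveI : (I.baseChange ℚ_[q]).IsElliptic := by rw [← hI, hC]; infer_instance
  -- `c_q` is the index of `E₀(ℚ_q)` of `I`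
  have hc : (W.baseChange ℚ_[q]).localTamagawaNumber ℤ_[q] =
      (I.nonsingularReductionSubgroup (integers_valuationRing_valuation ℤ_[q] ℚ_[q])).index := by
    change (((W.baseChange ℚ_[q]).minimal ℤ_[q]).goodReductionSubgroup ℤ_[q]).index = _
    rw [index_goodReductionSubgroup_congr_of_eq hI, goodReductionSubgroup_baseChange_eq]
  have hidx := localTamagawaNumber_padic_eq_one_or_three_of_hasKodairaIVOrIVstarAt W q hK
  rw [hc] at hidx
  -- FILE 1 on `I ⊗ ℚ_q`
  have key := CuspDivision.exists_ne_zero_and_nsmul_eq_zero_iff_index_eq_of_hasAdditiveReduction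
    ℤ_[q] I (integers_valuationRing_valuation ℤ_[q] ℚ_[q]) Nat.prime_three
    (isUnit_three_padicInt q hq3) hidx
  -- transport of the `3`-torsion along `W ⊗ ℚ_q ≃ C • (W ⊗ ℚ_q) = I ⊗ ℚ_q`
  have e : (W.baseChange ℚ_[q]).toAffine.Point ≃+ (I.baseChange ℚ_[q]).toAffine.Point :=
    (VariableChange.pointEquiv (W.baseChange ℚ_[q]) C).trans
      (Affine.Point.congrEquiv (hC.symm.trans hI))
  rw [exists_ne_zero_nsmul_eq_zero_iff_of_addEquiv e 3, hc]
  exact key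

end Summit.BirchSwinnertonDyer.Rank1Residual.Additive

end
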